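import Summits.BirchSwinnertonDyer.Rank1Residual.Additive.SharpenedStatements
import Literature.NumberTheory.EllipticCurves.RationalIsogenyPrimeDegreeJInvariants
import Literature.NumberTheory.EllipticCurves.OpenImage
import Literature.NumberTheory.EllipticCurves.QuadraticTwistJInvariantProofs
import HarnessLib

/-!
# Route `SchneiderFreeAdditiveX3` (K1 door), crux r3 `GordTwoBranchIMC` (item 19177): the `p = 37` instance made EXPLICIT — on the reducible
# (G-ord, `e = 2`) row at `37` every curve is `ℚ`-isomorphic to a quadratic twist of one of the two `X₀(37)` modulus curves
# `E₁ = [1,1,1,−8,6]` (`j = −7·11³`) and `E₂ = [1,1,1,−208083,−36621194]` (`j = −7·137³·2083³`), both of discriminant `−5³·7²`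

Cell `bsd-schneider-ideate`, seat `bsd-schneider-door-c5` (prover, generation 35; assembly layer; `--supports` 19177).  PARTITION: board row
B6 ∩ X3 ∩ sst-twist, `r = 1`, (G-ord, `e = 2`) half of `Rank1Residual.partition`, the `p = 37` row (EMPTY in the census `N < 5·10⁵`; the first
pair has `N = 5²·7²·37² = 1 677 025` — kit j334992: `r_an = 1`) — ASSEMBLY; types-the-object-of nothing new; closes nothing (BSD NOT advanced).
bears_on: K1-door (item 19177 r3 `GordTwoBranchIMC`; generation 35's `KYBranchRowPrimes`: the crux has content only at `p ∈ {3, 5, 7, 13, 37}`).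

WHAT.  Mazur's `j`-table (`mazur_j_mem_of_not_hasIrreducibleModPGaloisRep_of_eleven_le`, displayed) pins `j(W) ∈ {−9317, −162677523113838677}`
for a rational `37`-isogeny; the two `j`-invariants are those of the explicit curves `E₁`, `E₂` above (Zywina, arXiv:1508.07660 §4.8: `E₁` of
conductor `5²·7²` with a rational `37`-isogeny onto `E₂`), which are elliptic (`Δ = −6125`, §1) with these `j`-invariants (§1, kernel
arithmetic); curves with the same `j ∉ {0, 1728}` are quadratic twists (Silverman X.5.4, tree `exists_variableChange_eq_quadraticTwist_of_j_eq'`).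
* §1 `isElliptic_E₁` / `isElliptic_E₂`, `j_E₁` / `j_E₂` (kernel arithmetic on the literals).
* §2 **`exists_smul_eq_quadraticTwist_X0_37_of_red`**: `Red W 37` ⟹ `∃ d ≠ 0, ∃ C, C • W = E₁^{(d)} ∨ C • W = E₂^{(d)}`; in particular for every
  `W` with `ClassX3 W 37` (`exists_smul_eq_quadraticTwist_X0_37_of_classX3`).  So the crux's `p = 37` instance (one of its five, by
  `KYBranchRowPrimes.gordTwoBranchIMC_of_rowPrimes`) is a statement about the quadratic-twist family of ONE rational isogeny class.

HONEST FRAMING: §1 is unconditional kernel arithmetic; §2 is CONDITIONAL on Mazur's displayed `j`-table; no definition (the two curves appear as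
structure literals), no new named fact, no `sorry`; crux 19177 stays OPEN; BSD is proved for no curve; «closes rung: none».
References: Mazur, Invent. Math. 44 (1978) Thm. 1, table p. 129 [Mazur1978]; Zywina arXiv:1508.07660 §4.8 (the two curves) [Zywina2015];
Lozano-Robledo, Math. Ann. 357 (2013) Table 4 [LozanoRobledo2013MathAnn]; Silverman AEC X.5 Prop. 5.4, Cor. 5.4.1 [SilvermanAEC2009];
Cremona, *Algorithms* §3.8 p. 82 (class 1225h) [Cremona1997Algorithms].
-/

set_option autoImplicit false
-- `Summit.<P>.<Sub>` repeats `BirchSwinnertonDyer` by the tree's layout convention (D-0017)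
set_option linter.dupNamespace false

noncomputable section

open scoped Classical

open WeierstrassCurve Literature.NumberTheory.EllipticCurves Literature.NumberTheory.EllipticCurves.Rank1Residual
  Summit.BirchSwinnertonDyer.Rank1Residual

namespace Summit.BirchSwinnertonDyer.BirchSwinnertonDyer.Theorems.SchneiderFreeAdditiveX3.KYBranchThirtySevenRow

/-! ### §1 The two `X₀(37)` modulus curves: elliptic, `j = −7·11³` and `j = −7·137³·2083³` -/

/-- `E₁ = [1,1,1,−8,6]` (`y² + xy + y = x³ + x² − 8x + 6`, Cremona class `1225h`) has `Δ = −6125 = −5³·7² ≠ 0`: it is an elliptic curve.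
[cite: Zywina2015, §4.8] -/
theorem isElliptic_E₁ : (⟨1, 1, 1, -8, 6⟩ : WeierstrassCurve ℚ).IsElliptic := by
  rw [WeierstrassCurve.isElliptic_iff, isUnit_iff_ne_zero]
  norm_num [WeierstrassCurve.Δ, WeierstrassCurve.b₂, WeierstrassCurve.b₄, WeierstrassCurve.b₆, WeierstrassCurve.b₈]

/-- `E₂ = [1,1,1,−208083,−36621194]` (the `37`-isogenous partner of `E₁`) has `Δ = −6125 ≠ 0`: it is an elliptic curve. [cite: Zywina2015, §4.8] -/
theorem isElliptic_E₂ : (⟨1, 1, 1, -208083, -36621194⟩ : WeierstrassCurve ℚ).IsElliptic := by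
  rw [WeierstrassCurve.isElliptic_iff, isUnit_iff_ne_zero]
  norm_num [WeierstrassCurve.Δ, WeierstrassCurve.b₂, WeierstrassCurve.b₄, WeierstrassCurve.b₆, WeierstrassCurve.b₈]

/-- `j(E₁) = 385³/(−6125) = −9317 = −7·11³` (stated for a variable model equal to the literal, so as to apply under the instance-carrying `j`).
[cite: Zywina2015, §4.8] -/
theorem j_E₁ {V : WeierstrassCurve ℚ} [V.IsElliptic] (hV : V = ⟨1, 1, 1, -8, 6⟩) : V.j = -9317 := by
  subst hV
  rw [WeierstrassCurve.j, Units.val_inv_eq_inv_val, WeierstrassCurve.coe_Δ']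
  norm_num [WeierstrassCurve.c₄, WeierstrassCurve.b₂, WeierstrassCurve.b₄, WeierstrassCurve.Δ, WeierstrassCurve.b₆, WeierstrassCurve.b₈]

/-- `j(E₂) = 9987985³/(−6125) = −162677523113838677 = −7·137³·2083³`. [cite: Zywina2015, §4.8] -/
theorem j_E₂ {V : WeierstrassCurve ℚ} [V.IsElliptic] (hV : V = ⟨1, 1, 1, -208083, -36621194⟩) : V.j = -162677523113838677 := by
  subst hV
  rw [WeierstrassCurve.j, Units.val_inv_eq_inv_val, WeierstrassCurve.coe_Δ']
  norm_num [WeierstrassCurve.c₄, WeierstrassCurve.b₂, WeierstrassCurve.b₄, WeierstrassCurve.Δ, WeierstrassCurve.b₆, WeierstrassCurve.b₈]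

/-! ### §2 The row at `37`: quadratic twists of `E₁`, `E₂` -/

/-- **A curve over `ℚ` with a rational `37`-isogeny is `ℚ`-isomorphic to a quadratic twist of `E₁ = [1,1,1,−8,6]` or of
`E₂ = [1,1,1,−208083,−36621194]`**: by Mazur's `j`-table (displayed published fact) `j(W) ∈ {−9317, −162677523113838677} = {j(E₁), j(E₂)}`,
neither `0` nor `1728`, and curves with the same such `j` are quadratic twists (Silverman X.5.4; tree
`exists_variableChange_eq_quadraticTwist_of_j_eq'`).  CONDITIONAL on the displayed fact.
[cite: Mazur1978, Thm. 1 and table p. 129] [cite: LozanoRobledo2013MathAnn, Table 4] [cite: SilvermanAEC2009, X.5 Prop. 5.4 and Cor. 5.4.1] -/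
theorem exists_smul_eq_quadraticTwist_X0_37_of_red (hJ : mazur_j_mem_of_not_hasIrreducibleModPGaloisRep_of_eleven_le)
    (W : WeierstrassCurve ℚ) [W.IsElliptic] [Fact (Nat.Prime 37)] (hred : ¬ W.HasIrreducibleModPGaloisRep 37) :
    ∃ d : ℚ, d ≠ 0 ∧ ∃ C : VariableChange ℚ,
      C • W = (⟨1, 1, 1, -8, 6⟩ : WeierstrassCurve ℚ).quadraticTwist d ∨
        C • W = (⟨1, 1, 1, -208083, -36621194⟩ : WeierstrassCurve ℚ).quadraticTwist d := by
  haveI := isElliptic_E₁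
  haveI := isElliptic_E₂
  obtain ⟨h, -⟩ | ⟨h, -⟩ | ⟨h, -⟩ | ⟨-, hj⟩ | ⟨h, -⟩ | ⟨h, -⟩ | ⟨h, -⟩ := hJ W 37 (by norm_num) (by norm_num) hred
  · omega
  · omega
  · omega
  · rcases hj with hj | hj
    · have hjE : W.j = (⟨1, 1, 1, -8, 6⟩ : WeierstrassCurve ℚ).j := by rw [hj, j_E₁ rfl]
      obtain ⟨d, hd, C, hC⟩ := exists_variableChange_eq_quadraticTwist_of_j_eq' hjE (by rw [hj]; norm_num) (by rw [hj]; norm_num)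
      exact ⟨d, hd, C, Or.inl hC⟩
    · have hjE : W.j = (⟨1, 1, 1, -208083, -36621194⟩ : WeierstrassCurve ℚ).j := by rw [hj, j_E₂ rfl]
      obtain ⟨d, hd, C, hC⟩ := exists_variableChange_eq_quadraticTwist_of_j_eq' hjE (by rw [hj]; norm_num) (by rw [hj]; norm_num)
      exact ⟨d, hd, C, Or.inr hC⟩
  · omega
  · omega
  · omega

/-- **The reducible (G-ord, `e = 2`) row at `p = 37` — the fifth prime of crux r3 — consists of `ℚ`-isomorphs of quadratic twists of the two
`X₀(37)` modulus curves**: for every globally minimal `W` with `ClassX3 W 37` (and any cell condition), `C • W = E₁^{(d)}` or `E₂^{(d)}`.  So the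
crux's `p = 37` instance (`KYBranchRowPrimes.gordTwoBranchIMC_of_rowPrimes`) is a statement about ONE rational isogeny class's twist family
(`37 ∣ d` forced by `Addv W 37`, since `E₁, E₂` are good at `37`; kit j334992 exhibits `E₁^{(37)}` with `r_an = 1`).  CONDITIONAL on Mazur's
displayed `j`-table. [cite: Mazur1978, Thm. 1 and table p. 129] [cite: SilvermanAEC2009, X.5 Prop. 5.4 and Cor. 5.4.1] -/
theorem exists_smul_eq_quadraticTwist_X0_37_of_classX3 (hJ : mazur_j_mem_of_not_hasIrreducibleModPGaloisRep_of_eleven_le)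
    (W : WeierstrassCurve ℚ) [W.IsElliptic] [Fact (Nat.Prime 37)] (hX : ClassX3 W 37) :
    ∃ d : ℚ, d ≠ 0 ∧ ∃ C : VariableChange ℚ,
      C • W = (⟨1, 1, 1, -8, 6⟩ : WeierstrassCurve ℚ).quadraticTwist d ∨
        C • W = (⟨1, 1, 1, -208083, -36621194⟩ : WeierstrassCurve ℚ).quadraticTwist d :=
  exists_smul_eq_quadraticTwist_X0_37_of_red hJ W hX.1

end Summit.BirchSwinnertonDyer.BirchSwinnertonDyer.Theorems.SchneiderFreeAdditiveX3.KYBranchThirtySevenRow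

end
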